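import Mathlib
import Literature.AlgebraicGeometry.Resolution.DerivativeIdealsLocalization
import HarnessLib

/-!
# Crux `Picover` (stmt-ResolutionOfSingularities-0554), line `degree-p-tower`:
# characteristic-`2` Morse points of `g` die in one blow-up of the regular base

Registered helper `morse_dies_in_one_blowup_char_two` (brick H3 of the Hirokado engine for
`p = 2`). Setting: `(R, 𝔪, κ)` a regular local ring of characteristic `2` with a regular system of
parameters `x₁, …, x_d` and dual derivations `D_i` (`D_i x_j = δ_ij`), `g ∈ 𝔪²` whose polar form
`B_ij = (D_i D_j g)(0) ∈ κ` is non-degenerate. In the `x_{i₀}`-chart `R₁ = R[x_j / x_{i₀}] ⊆ K`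
of the blow-up of `𝔪`: `g = x_{i₀}² g₁` with `g₁ ∈ R₁`, and at every prime `𝔮 ∋ x_{i₀}` of `R₁`
(the exceptional divisor) some `ℤ`-derivation `D₁` of `R₁` has `D₁ g₁ ∉ 𝔮`.

Proof. Write `g = ∑ x_k x_l c_kl`; then `g₁ = ∑ u_k u_l c_kl` (`u_k = x_k / x_{i₀}`), the polar
matrix is `B = S̄` with `S = c + cᵀ` symmetric with ZERO diagonal (`2 = 0`), and `det S ∈ R×`.
For `j ≠ i₀` the derivation `x_{i₀} · D̃_j` of `K` (`D̃_j` the extension of `D_j` to `K = Frac R`,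
`exists_derivation_extend_of_isLocalization`) maps `r ↦ x_{i₀} D_j r`, `u_k ↦ δ_jk`, hence
restricts to a derivation `E_j` of `R₁` with `E_j g₁ ≡ ∑_k S_jk u_k (mod x_{i₀} R₁)`. If all
`E_j g₁ ∈ 𝔮` then in `A = R₁/𝔮` the vector `v = ū` (`v_{i₀} = 1`) has `(S̄ v)_j = 0` for
`j ≠ i₀`, and `vᵀ S̄ v = 0` (alternating) forces `(S̄ v)_{i₀} = 0` too; as `det S̄ ∈ A×`, `v = 0`,
contradicting `v_{i₀} = 1`. No statement item is restated.
-/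

set_option linter.dupNamespace false -- mandated namespace of this single-conjunct summit

universe u

namespace Summit.ResolutionOfSingularities.ResolutionOfSingularities.Theorems.Picover.MorseCharTwo

open IsLocalRing Matrix
open Literature.AlgebraicGeometry.Resolution

/-- Leibniz along a coordinate system: if `D x_k = δ_ik` then
`D (∑ x_k f_k) = ∑ x_k D f_k + f_i`. [folklore] -/
private theorem derivation_sum_mul_eq {S₀ A : Type*} [CommSemiring S₀] [CommRing A] [Algebra S₀ A]
    {d : ℕ} (D : Derivation S₀ A A) (x f : Fin d → A) (i : Fin d)
    (hD : ∀ k, D (x k) = if i = k then 1 else 0) :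
    D (∑ k, x k * f k) = (∑ k, x k * D (f k)) + f i := by
  rw [map_sum]
  simp only [Derivation.leibniz, smul_eq_mul, hD, mul_ite, mul_one, mul_zero,
    Finset.sum_add_distrib, Finset.sum_ite_eq, Finset.mem_univ, if_true]

/-- First-order Taylor coefficient: modulo the maximal ideal, `D_i (∑ x_k f_k) ≡ f_i` when the
`x_k` lie in `𝔪` and `D_i x_k = δ_ik`. [folklore] -/
private theorem residue_derivation_sum_mul {R : Type u} [CommRing R] [IsLocalRing R] {d : ℕ}
    (x : Fin d → R) (hx : ∀ k, x k ∈ maximalIdeal R) (D : Derivation ℤ R R) (i : Fin d)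
    (hD : ∀ k, D (x k) = if i = k then 1 else 0) (f : Fin d → R) :
    residue R (D (∑ k, x k * f k)) = residue R (f i) := by
  rw [derivation_sum_mul_eq D x f i hD, map_add, map_sum]
  have h0 : ∀ k, residue R (x k * D (f k)) = 0 := fun k => by
    rw [map_mul, (residue_eq_zero_iff _).mpr (hx k), zero_mul]
  simp [h0]

/-- An element of `(x₁, …, x_d)²` is a quadratic form `∑ x_k x_l c_kl` in the generators.
[folklore] -/
private theorem exists_coeff_of_mem_sq {R : Type u} [CommRing R] {d : ℕ} (x : Fin d → R) {g : R}
    (hg : g ∈ Ideal.span (Set.range x) ^ 2) :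
    ∃ c : Fin d → Fin d → R, g = ∑ k, x k * ∑ l, x l * c k l := by
  rw [pow_two] at hg
  refine Submodule.mul_induction_on hg (fun a ha b hb => ?_) (fun a b ha hb => ?_)
  · obtain ⟨α, rfl⟩ := Ideal.mem_span_range_iff_exists_fun.mp ha
    obtain ⟨β, rfl⟩ := Ideal.mem_span_range_iff_exists_fun.mp hb
    refine ⟨fun k l => α k * β l, ?_⟩
    rw [Finset.sum_mul]
    refine Finset.sum_congr rfl fun k _ => ?_
    rw [Finset.mul_sum, Finset.mul_sum]
    refine Finset.sum_congr rfl fun l _ => ?_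
    dsimp only
    ring
  · obtain ⟨ca, rfl⟩ := ha
    obtain ⟨cb, rfl⟩ := hb
    refine ⟨ca + cb, ?_⟩
    rw [← Finset.sum_add_distrib]
    refine Finset.sum_congr rfl fun k _ => ?_
    rw [← mul_add, ← Finset.sum_add_distrib]
    congr 1
    refine Finset.sum_congr rfl fun l _ => ?_
    simp only [Pi.add_apply]
    ring

/-- A symmetric double sum with vanishing diagonal vanishes when `2 = 0`. [folklore] -/
private theorem sum_sum_eq_zero_of_symm {A : Type*} [AddCommGroup A] {n : ℕ}
    (a : Fin n → Fin n → A) (hsymm : ∀ j k, a j k = a k j) (hdiag : ∀ j, a j j = 0)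
    (h2 : ∀ z : A, z + z = 0) : ∑ j, ∑ k, a j k = 0 := by
  rw [← Fintype.sum_prod_type']
  refine Finset.sum_ninvolution Prod.swap (fun p => ?_) (fun p hp => ?_)
    (fun p => Finset.mem_univ _) (fun p => Prod.swap_swap p)
  · rw [Prod.fst_swap, Prod.snd_swap, hsymm p.2 p.1, h2]
  · intro h
    apply hp
    have h1 : p.2 = p.1 := congrArg Prod.fst h
    rw [h1]
    exact hdiag _

/-- **Linear algebra of the contradiction.** Over a nontrivial ring `A` with `2 = 0`, a symmetric
matrix `S` with zero diagonal and unit determinant admits no vector `v` with `v_{i₀} = 1` and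
`(S v)_j = 0` for all `j ≠ i₀`: the alternating identity `vᵀ S v = 0` gives `(S v)_{i₀} = 0` as
well, so `v = 0`. [folklore] -/
private theorem false_of_symm_zero_diag {R A : Type*} [CommRing R] [CommRing A] [Nontrivial A]
    (φ : R →+* A) {d : ℕ} (S : Matrix (Fin d) (Fin d) R) (hS : ∀ j k, S j k = S k j)
    (hSd : ∀ j, S j j = 0) (hdet : IsUnit S.det) (h2 : ∀ z : A, z + z = 0) (v : Fin d → A)
    (i₀ : Fin d) (hv : v i₀ = 1) (hv' : ∀ j, j ≠ i₀ → ∑ k, φ (S j k) * v k = 0) : False := by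
  set M : Matrix (Fin d) (Fin d) A := S.map φ with hM
  have hMv : ∀ j, j ≠ i₀ → M.mulVec v j = 0 := fun j hj => by
    simpa [hM, Matrix.mulVec, dotProduct] using hv' j hj
  have hsum0 : ∑ j, ∑ k, v j * M j k * v k = 0 :=
    sum_sum_eq_zero_of_symm (fun j k => v j * M j k * v k)
      (fun j k => by simp only [hM, Matrix.map_apply, hS j k]; ring)
      (fun j => by simp only [hM, Matrix.map_apply, hSd, map_zero, mul_zero, zero_mul]) h2
  have hi₀ : M.mulVec v i₀ = 0 := by
    calc M.mulVec v i₀ = v i₀ * M.mulVec v i₀ := by rw [hv, one_mul]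
      _ = ∑ j, v j * M.mulVec v j := by
          rw [Finset.sum_eq_single i₀]
          · intro j _ hj
            rw [hMv j hj, mul_zero]
          · intro h
            exact absurd (Finset.mem_univ _) h
      _ = ∑ j, ∑ k, v j * M j k * v k := by
          simp only [Matrix.mulVec, dotProduct, Finset.mul_sum, mul_assoc]
      _ = 0 := hsum0
  have hMv0 : M.mulVec v = 0 := by
    funext j
    rcases eq_or_ne j i₀ with rfl | hj
    · exact hi₀
    · exact hMv j hj
  have hdetM : IsUnit M.det := by
    have h := hdet.map φ
    rwa [RingHom.map_det, RingHom.mapMatrix_apply] at h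
  have hv0 : v = 0 := by
    calc v = (M⁻¹ * M).mulVec v := by rw [Matrix.nonsing_inv_mul _ hdetM, Matrix.one_mulVec]
      _ = M⁻¹.mulVec (M.mulVec v) := by rw [Matrix.mulVec_mulVec]
      _ = 0 := by rw [hMv0, Matrix.mulVec_zero]
  have : v i₀ = 0 := by rw [hv0]; rfl
  exact one_ne_zero (hv.symm.trans this)

/-- **Restriction of a derivation of the fraction field to a chart algebra.** If `δ` is a
derivation of `K ⊇ R` and `y ∈ K` is such that `y · δ` maps `R` and the generators `u_i` into
`R[u_i] ⊆ K`, then `y · δ` restricts to a derivation `E` of `R[u_i]`. [folklore] -/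
private theorem exists_derivation_adjoin {R K : Type u} [CommRing R] [Field K] [Algebra R K]
    (δ : Derivation ℤ K K) (y : K) {ι : Type*} (u : ι → K)
    (hR : ∀ r : R, y * δ (algebraMap R K r) ∈ Algebra.adjoin R (Set.range u))
    (hu : ∀ i, y * δ (u i) ∈ Algebra.adjoin R (Set.range u)) :
    ∃ E : Derivation ℤ (Algebra.adjoin R (Set.range u)) (Algebra.adjoin R (Set.range u)),
      ∀ z, (E z : K) = y * δ z := by
  set R₁ := Algebra.adjoin R (Set.range u)
  have hmem : ∀ z ∈ R₁, y * δ z ∈ R₁ := by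
    intro z hz
    induction hz using Algebra.adjoin_induction with
    | mem z hz =>
      obtain ⟨i, rfl⟩ := hz
      exact hu i
    | algebraMap r => exact hR r
    | add a b _ _ ha hb =>
      rw [map_add, mul_add]
      exact add_mem ha hb
    | mul a b ha' hb' ha hb =>
      rw [Derivation.leibniz, smul_eq_mul, smul_eq_mul, mul_add, mul_left_comm y a,
        mul_left_comm y b]
      exact add_mem (mul_mem ha' hb) (mul_mem hb' ha)
  let E₀ : R₁ →+ R₁ :=
    { toFun := fun z => ⟨y * δ z, hmem z z.2⟩
      map_zero' := Subtype.ext (by simp)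
      map_add' := fun a b => Subtype.ext (by simp [mul_add]) }
  refine ⟨Derivation.mk' E₀.toIntLinearMap fun a b => Subtype.ext ?_, fun z => rfl⟩
  change y * δ ((a : K) * b) = (a : K) * (y * δ b) + (b : K) * (y * δ a)
  rw [Derivation.leibniz, smul_eq_mul, smul_eq_mul]
  ring

/-- **Characteristic-`2` Morse points die in one blow-up** (brick H3 of the Hirokado engine,
`p = 2`): for `R` regular local of characteristic `2` with regular system of parameters `x` and
dual derivations `D_i`, and `g ∈ 𝔪²` with non-degenerate polar form `(D_i D_j g)(0)`, in the
`x_{i₀}`-chart `R₁ = R[x_j/x_{i₀}]` of the blow-up of `𝔪` one has `g = x_{i₀}² g₁`, and at every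
prime `𝔮 ∋ x_{i₀}` of `R₁` some `ℤ`-derivation `D₁` of `R₁` satisfies `D₁ g₁ ∉ 𝔮`. [folklore] -/
theorem morse_dies_in_one_blowup_char_two : ∀ {R : Type u} [CommRing R] [IsRegularLocalRing R] [CharP R 2] {d : ℕ} (x : Fin d → R), Ideal.span (Set.range x) = IsLocalRing.maximalIdeal R → (d : WithBot ℕ∞) = ringKrullDim R → ∀ (D : Fin d → Derivation ℤ R R), (∀ i j, D i (x j) = if i = j then 1 else 0) → ∀ (g : R), g ∈ IsLocalRing.maximalIdeal R ^ 2 → IsUnit (Matrix.det (Matrix.of fun i j : Fin d => IsLocalRing.residue R (D i (D j g)))) → ∀ (K : Type u) [Field K] [Algebra R K] [IsFractionRing R K] (i₀ : Fin d) (R₁ : Subalgebra R K), R₁ = Algebra.adjoin R (Set.range fun j : Fin d => algebraMap R K (x j) / algebraMap R K (x i₀)) → ∃ g₁ : R₁, algebraMap R K g = algebraMap R K (x i₀) ^ 2 * (g₁ : K) ∧ ∀ 𝔮 : Ideal R₁, 𝔮.IsPrime → algebraMap R R₁ (x i₀) ∈ 𝔮 → ∃ D₁ : Derivation ℤ R₁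 R₁, D₁ g₁ ∉ 𝔮 := by
  intro R _ _ _ d x hx _ D hD g hg hdet K _ _ _ i₀ R₁ hR₁
  subst hR₁
  set y : K := algebraMap R K (x i₀) with hy_def
  set u : Fin d → K := fun j => algebraMap R K (x j) / y with hu_def
  set R₁ : Subalgebra R K := Algebra.adjoin R (Set.range u) with hR₁_def
  -- basic facts
  have hx0 : x i₀ ≠ 0 := by
    intro h
    have h1 := hD i₀ i₀
    rw [h, map_zero, if_pos rfl] at h1
    exact zero_ne_one h1
  have hy : y ≠ 0 := fun h => hx0 (IsFractionRing.injective R K (by rw [map_zero]; exact h))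
  have hxmem : ∀ k, x k ∈ maximalIdeal R := fun k => hx ▸ Ideal.subset_span ⟨k, rfl⟩
  have hyu : ∀ k, y * u k = algebraMap R K (x k) := fun k => mul_div_cancel₀ _ hy
  obtain ⟨U, hU⟩ : ∃ U : Fin d → R₁, ∀ k, (U k : K) = u k :=
    ⟨fun k => ⟨u k, Algebra.subset_adjoin ⟨k, rfl⟩⟩, fun k => rfl⟩
  have hU0 : U i₀ = 1 := Subtype.ext (by rw [hU]; exact div_self hy)
  -- the quadratic representation of `g` and the element `g₁`
  rw [← hx] at hg
  obtain ⟨c, hc⟩ := exists_coeff_of_mem_sq x hg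
  obtain ⟨g₁, hg₁⟩ : ∃ g₁ : R₁, g₁ = ∑ k, U k * ∑ l, U l * algebraMap R R₁ (c k l) := ⟨_, rfl⟩
  have hg₁K : algebraMap R K g = y ^ 2 * (g₁ : K) := by
    have hcoe : (g₁ : K) = ∑ k, u k * ∑ l, u l * algebraMap R K (c k l) := by
      simp [hg₁, hU]
    rw [hcoe, hc, map_sum, Finset.mul_sum]
    refine Finset.sum_congr rfl fun k _ => ?_
    simp only [map_mul, map_sum, Finset.mul_sum]
    refine Finset.sum_congr rfl fun l _ => ?_
    rw [← hyu k, ← hyu l]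
    ring
  -- the polar matrix `S = c + cᵀ`
  set S : Matrix (Fin d) (Fin d) R := Matrix.of fun i j => c i j + c j i with hS_def
  have hS : ∀ j k, S j k = S k j := fun j k => by
    simp only [hS_def, Matrix.of_apply]; exact add_comm _ _
  have hSd : ∀ j, S j j = 0 := fun j => by
    simp only [hS_def, Matrix.of_apply]; exact CharTwo.add_self_eq_zero _
  have key : ∀ i j, residue R (D i (D j g)) = residue R (c i j + c j i) := by
    intro i j
    rw [hc, derivation_sum_mul_eq (D j) x _ j (hD j), map_add, map_add,
      residue_derivation_sum_mul x hxmem (D i) i (hD i),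
      residue_derivation_sum_mul x hxmem (D j) j (hD j),
      residue_derivation_sum_mul x hxmem (D i) i (hD i), ← map_add]
  have hdetS : IsUnit S.det := by
    have hBS : (Matrix.of fun i j : Fin d => residue R (D i (D j g))) = S.map (residue R) := by
      ext i j
      simp only [Matrix.of_apply, Matrix.map_apply, hS_def]
      exact key i j
    rw [hBS, ← RingHom.mapMatrix_apply, ← RingHom.map_det] at hdet
    exact (isUnit_map_iff (residue R) _).mp hdet
  -- the derivations `E_j = x_{i₀} · D̃_j` of `R₁`, `j ≠ i₀`
  have hE : ∀ j, j ≠ i₀ → ∃ E : Derivation ℤ R₁ R₁,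
      (∀ r, E (algebraMap R R₁ r) = algebraMap R R₁ (x i₀) * algebraMap R R₁ (D j r)) ∧
      ∀ k, E (U k) = if j = k then 1 else 0 := by
    intro j hj
    obtain ⟨δ, hδ⟩ := exists_derivation_extend_of_isLocalization ℤ K (nonZeroDivisors R) (D j)
    have hδy : δ y = 0 := by
      rw [hy_def, hδ, hD, if_neg hj, map_zero]
    have hδu : ∀ k, y * δ (u k) = algebraMap R K (if j = k then 1 else 0) := by
      intro k
      have h := congrArg δ (hyu k)
      rw [Derivation.leibniz, hδy, smul_zero, add_zero, hδ, hD, smul_eq_mul] at h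
      exact h
    have hRmem : ∀ r : R, y * δ (algebraMap R K r) ∈ Algebra.adjoin R (Set.range u) := by
      intro r
      rw [hδ, hy_def, ← map_mul]
      exact Subalgebra.algebraMap_mem _ _
    have humem : ∀ k, y * δ (u k) ∈ Algebra.adjoin R (Set.range u) := by
      intro k
      rw [hδu]
      exact Subalgebra.algebraMap_mem _ _
    obtain ⟨E, hE⟩ := exists_derivation_adjoin (R := R) δ y u hRmem humem
    refine ⟨E, fun r => Subtype.ext ?_, fun k => Subtype.ext ?_⟩
    · rw [hE, Subalgebra.coe_mul, Subalgebra.coe_algebraMap, Subalgebra.coe_algebraMap,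
        Subalgebra.coe_algebraMap, hδ]
    · rw [hE, hU, hδu]
      split_ifs <;> simp
  -- conclusion
  refine ⟨g₁, hg₁K, fun 𝔮 h𝔮 hy𝔮 => ?_⟩
  by_contra hall
  push Not at hall
  haveI : Nontrivial (R₁ ⧸ 𝔮) := Ideal.Quotient.nontrivial_iff.mpr h𝔮.ne_top
  set π : R₁ →+* R₁ ⧸ 𝔮 := Ideal.Quotient.mk 𝔮 with hπ_def
  have hπy : π (algebraMap R R₁ (x i₀)) = 0 := Ideal.Quotient.eq_zero_iff_mem.mpr hy𝔮
  have h2 : ∀ z : R₁ ⧸ 𝔮, z + z = 0 := fun z => by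
    have h22 : (2 : R₁ ⧸ 𝔮) = 0 := by
      rw [← map_ofNat (π.comp (algebraMap R R₁)) 2, CharTwo.two_eq_zero, map_zero]
    rw [← two_mul, h22, zero_mul]
  refine false_of_symm_zero_diag (π.comp (algebraMap R R₁)) S hS hSd hdetS h2 (fun k => π (U k))
    i₀ (by simp only [hU0, map_one]) fun j hj => ?_
  obtain ⟨E, hEr, hEU⟩ := hE j hj
  have h1 : π (E g₁) = 0 := Ideal.Quotient.eq_zero_iff_mem.mpr (hall E)
  have hEg₁ : E g₁ = (∑ k, U k * ((∑ l, U l * (algebraMap R R₁ (x i₀) *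
      algebraMap R R₁ (D j (c k l)))) + algebraMap R R₁ (c k j))) +
      ∑ l, U l * algebraMap R R₁ (c j l) := by
    rw [hg₁, derivation_sum_mul_eq E U _ j hEU]
    congr 1
    refine Finset.sum_congr rfl fun k _ => ?_
    rw [derivation_sum_mul_eq E U _ j hEU]
    simp only [hEr]
  rw [hEg₁] at h1
  simp only [map_add, map_sum, map_mul, hπy, zero_mul, mul_zero, Finset.sum_const_zero,
    zero_add] at h1
  rw [← h1, ← Finset.sum_add_distrib]
  refine Finset.sum_congr rfl fun k _ => ?_
  simp only [hS_def, Matrix.of_apply, map_add, RingHom.comp_apply]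
  ring

end Summit.ResolutionOfSingularities.ResolutionOfSingularities.Theorems.Picover.MorseCharTwo
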